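import Summits.Ventures.PercRepro2.CaseOneGadgetUWOAnchor
import Summits.Ventures.PercRepro2.CaseOneNullEdgeClasses

/-!
# The absent-edge faces of the uwob and uwo gadget rows (blind cell PercRepro2, p1 g29; S5 §2.3,
four degree-`2` classes of the statement vertex closed by `closedAt_of_ext`)

«Every absent-edge face of a closed graph is closed» (`closedAt_of_ext`, p1 g28) applied to two of the
three gadget anchors of the rung — uwob (`u ~ {w, o, b}`, `w ~ {u, a₁, a₂}`) and uwo (`u ~ {w, o}`,
`w ~ {u, a₁, a₂, b}`) — with one gadget edge absent: the statement vertex `u` of degree `2`, adjacent to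
one mark and to an unmarked hub `w` whose other neighbours are two marks. The four faces (single
edges, `w` unmarked; the faces with an absent edge at a series vertex or a leaf are already in the
moves closure): `u ~ {w, o}, w ~ {u, a₁, a₂}` · `u ~ {w, b}, w ~ {u, a₁, a₂}` ·
`u ~ {w, o}, w ~ {u, a₁, b}` · `u ~ {w, o}, w ~ {u, a₂, b}`. Each is one null edge away from its
gadget; the three faces of the uwa1 gadget are in `CaseOneGadgetFacesUWA1`. Own code; standard axioms.
-/

namespace Summit.Ventures.PercRepro2

namespace CaseOne

universe u

section Faces
variable {V : Type*} [Fintype V] [DecidableEq V] {E : Type u} [Fintype E] [DecidableEq E]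
  {R : Type*} [Field R] [LinearOrder R] [IsStrictOrderedRing R]
variable {ends : E → Sym2 V} {o a₁ a₂ b u w : V}

/-! ### Faces of the uwob gadget -/

/-- **`u ~ {w, o}`, `w ~ {u, a₁, a₂}` is closed**: a null edge `{b, u}` makes it the uwob gadget. -/
theorem closedAt_of_face_uwo_wa1a2 {euw euo ewa1 ewa2 : E} (huw : ends euw = s(w, u))
    (huo : ends euo = s(o, u)) (hwa1 : ends ewa1 = s(a₁, w)) (hwa2 : ends ewa2 = s(a₂, w))
    (h_uw_uo : euw ≠ euo) (h_uw_wa1 : euw ≠ ewa1) (h_uw_wa2 : euw ≠ ewa2) (h_uo_wa1 : euo ≠ ewa1)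
    (h_uo_wa2 : euo ≠ ewa2) (h_wa1_wa2 : ewa1 ≠ ewa2) (hu : ∀ e, u ∈ ends e → e = euw ∨ e = euo)
    (hw : ∀ e, w ∈ ends e → e = euw ∨ e = ewa1 ∨ e = ewa2) (hwu : w ≠ u) (hou : o ≠ u)
    (hbu : b ≠ u) (ha1u : a₁ ≠ u) (ha2u : a₂ ≠ u) (ha1w : a₁ ≠ w) (ha2w : a₂ ≠ w) (how : o ≠ w)
    (hbw : b ≠ w) : ClosedAt R o a₁ a₂ b E ends u := by
  refine closedAt_of_ext (s := s(b, u)) (closedAt_of_closedAnchor o a₁ a₂ b _ _ u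
    (Or.inr (Or.inr (Or.inl ⟨w, some euw, some euo, none, some ewa1, some ewa2, ?_⟩))))
  exact
    { ends_uw := by simp [huw]
      ends_uo := by simp [huo]
      ends_ub := rfl
      ends_wa1 := by simp [hwa1]
      ends_wa2 := by simp [hwa2]
      ne_uw_uo := by simp [h_uw_uo]
      ne_uw_ub := by simp
      ne_uw_wa1 := by simp [h_uw_wa1]
      ne_uw_wa2 := by simp [h_uw_wa2]
      ne_uo_ub := by simp
      ne_uo_wa1 := by simp [h_uo_wa1]
      ne_uo_wa2 := by simp [h_uo_wa2]
      ne_ub_wa1 := by simp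
      ne_ub_wa2 := by simp
      ne_wa1_wa2 := by simp [h_wa1_wa2]
      unique_u := by
        intro e he
        cases e with
        | none => exact Or.inr (Or.inr rfl)
        | some e =>
          rcases hu e he with h | h
          · exact Or.inl (by rw [h])
          · exact Or.inr (Or.inl (by rw [h]))
      unique_w := by
        intro e he
        cases e with
        | none => exact absurd he (by simp [extEnds, Sym2.mem_iff, hwu, hbw.symm])
        | some e =>
          rcases hw e he with h | h | h
          · exact Or.inl (by rw [h])
          · exact Or.inr (Or.inl (by rw [h]))
          · exact Or.inr (Or.inr (by rw [h]))
      ne_wu := hwu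
      ne_ou := hou
      ne_bu := hbu
      ne_a1u := ha1u
      ne_a2u := ha2u
      ne_a1w := ha1w
      ne_a2w := ha2w
      ne_ow := how
      ne_bw := hbw }

/-- **`u ~ {w, b}`, `w ~ {u, a₁, a₂}` is closed**: a null edge `{o, u}` makes it the uwob gadget. -/
theorem closedAt_of_face_uwb_wa1a2 {euw eub ewa1 ewa2 : E} (huw : ends euw = s(w, u))
    (hub : ends eub = s(b, u)) (hwa1 : ends ewa1 = s(a₁, w)) (hwa2 : ends ewa2 = s(a₂, w))
    (h_uw_ub : euw ≠ eub) (h_uw_wa1 : euw ≠ ewa1) (h_uw_wa2 : euw ≠ ewa2) (h_ub_wa1 : eub ≠ ewa1)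
    (h_ub_wa2 : eub ≠ ewa2) (h_wa1_wa2 : ewa1 ≠ ewa2) (hu : ∀ e, u ∈ ends e → e = euw ∨ e = eub)
    (hw : ∀ e, w ∈ ends e → e = euw ∨ e = ewa1 ∨ e = ewa2) (hwu : w ≠ u) (hou : o ≠ u)
    (hbu : b ≠ u) (ha1u : a₁ ≠ u) (ha2u : a₂ ≠ u) (ha1w : a₁ ≠ w) (ha2w : a₂ ≠ w) (how : o ≠ w)
    (hbw : b ≠ w) : ClosedAt R o a₁ a₂ b E ends u := by
  refine closedAt_of_ext (s := s(o, u)) (closedAt_of_closedAnchor o a₁ a₂ b _ _ u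
    (Or.inr (Or.inr (Or.inl ⟨w, some euw, none, some eub, some ewa1, some ewa2, ?_⟩))))
  exact
    { ends_uw := by simp [huw]
      ends_uo := rfl
      ends_ub := by simp [hub]
      ends_wa1 := by simp [hwa1]
      ends_wa2 := by simp [hwa2]
      ne_uw_uo := by simp
      ne_uw_ub := by simp [h_uw_ub]
      ne_uw_wa1 := by simp [h_uw_wa1]
      ne_uw_wa2 := by simp [h_uw_wa2]
      ne_uo_ub := by simp
      ne_uo_wa1 := by simp
      ne_uo_wa2 := by simp
      ne_ub_wa1 := by simp [h_ub_wa1]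
      ne_ub_wa2 := by simp [h_ub_wa2]
      ne_wa1_wa2 := by simp [h_wa1_wa2]
      unique_u := by
        intro e he
        cases e with
        | none => exact Or.inr (Or.inl rfl)
        | some e =>
          rcases hu e he with h | h
          · exact Or.inl (by rw [h])
          · exact Or.inr (Or.inr (by rw [h]))
      unique_w := by
        intro e he
        cases e with
        | none => exact absurd he (by simp [extEnds, Sym2.mem_iff, hwu, how.symm])
        | some e =>
          rcases hw e he with h | h | h
          · exact Or.inl (by rw [h])
          · exact Or.inr (Or.inl (by rw [h]))
          · exact Or.inr (Or.inr (by rw [h]))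
      ne_wu := hwu
      ne_ou := hou
      ne_bu := hbu
      ne_a1u := ha1u
      ne_a2u := ha2u
      ne_a1w := ha1w
      ne_a2w := ha2w
      ne_ow := how
      ne_bw := hbw }

/-! ### Faces of the uwo gadget -/

/-- **`u ~ {w, o}`, `w ~ {u, a₁, b}` is closed**: a null edge `{a₂, w}` makes it the uwo gadget. -/
theorem closedAt_of_face_uwo_wa1b {euw euo ewa1 ewb : E} (huw : ends euw = s(w, u))
    (huo : ends euo = s(o, u)) (hwa1 : ends ewa1 = s(a₁, w)) (hwb : ends ewb = s(b, w))
    (h_uw_uo : euw ≠ euo) (h_uw_wa1 : euw ≠ ewa1) (h_uw_wb : euw ≠ ewb) (h_uo_wa1 : euo ≠ ewa1)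
    (h_uo_wb : euo ≠ ewb) (h_wa1_wb : ewa1 ≠ ewb) (hu : ∀ e, u ∈ ends e → e = euw ∨ e = euo)
    (hw : ∀ e, w ∈ ends e → e = euw ∨ e = ewa1 ∨ e = ewb) (hwu : w ≠ u) (hou : o ≠ u)
    (hbu : b ≠ u) (ha1u : a₁ ≠ u) (ha2u : a₂ ≠ u) (ha1w : a₁ ≠ w) (ha2w : a₂ ≠ w) (how : o ≠ w)
    (hbw : b ≠ w) : ClosedAt R o a₁ a₂ b E ends u := by
  refine closedAt_of_ext (s := s(a₂, w)) (closedAt_of_gadgetUWOAnchor o a₁ a₂ b _ _ u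
    ⟨w, some euw, some euo, some ewa1, none, some ewb, ?_⟩)
  exact
    { ends_uw := by simp [huw]
      ends_uo := by simp [huo]
      ends_wa1 := by simp [hwa1]
      ends_wa2 := rfl
      ends_wb := by simp [hwb]
      ne_uw_uo := by simp [h_uw_uo]
      ne_uw_wa1 := by simp [h_uw_wa1]
      ne_uw_wa2 := by simp
      ne_uw_wb := by simp [h_uw_wb]
      ne_uo_wa1 := by simp [h_uo_wa1]
      ne_uo_wa2 := by simp
      ne_uo_wb := by simp [h_uo_wb]
      ne_wa1_wa2 := by simp
      ne_wa1_wb := by simp [h_wa1_wb]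
      ne_wa2_wb := by simp
      unique_u := by
        intro e he
        cases e with
        | none => exact absurd he (by simp [extEnds, Sym2.mem_iff, ha2u.symm, hwu.symm])
        | some e =>
          rcases hu e he with h | h
          · exact Or.inl (by rw [h])
          · exact Or.inr (by rw [h])
      unique_w := by
        intro e he
        cases e with
        | none => exact Or.inr (Or.inr (Or.inl rfl))
        | some e =>
          rcases hw e he with h | h | h
          · exact Or.inl (by rw [h])
          · exact Or.inr (Or.inl (by rw [h]))
          · exact Or.inr (Or.inr (Or.inr (by rw [h])))
      ne_wu := hwu
      ne_ou := hou
      ne_bu := hbu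
      ne_a1u := ha1u
      ne_a2u := ha2u
      ne_a1w := ha1w
      ne_a2w := ha2w
      ne_ow := how
      ne_bw := hbw }

/-- **`u ~ {w, o}`, `w ~ {u, a₂, b}` is closed**: a null edge `{a₁, w}` makes it the uwo gadget. -/
theorem closedAt_of_face_uwo_wa2b {euw euo ewa2 ewb : E} (huw : ends euw = s(w, u))
    (huo : ends euo = s(o, u)) (hwa2 : ends ewa2 = s(a₂, w)) (hwb : ends ewb = s(b, w))
    (h_uw_uo : euw ≠ euo) (h_uw_wa2 : euw ≠ ewa2) (h_uw_wb : euw ≠ ewb) (h_uo_wa2 : euo ≠ ewa2)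
    (h_uo_wb : euo ≠ ewb) (h_wa2_wb : ewa2 ≠ ewb) (hu : ∀ e, u ∈ ends e → e = euw ∨ e = euo)
    (hw : ∀ e, w ∈ ends e → e = euw ∨ e = ewa2 ∨ e = ewb) (hwu : w ≠ u) (hou : o ≠ u)
    (hbu : b ≠ u) (ha1u : a₁ ≠ u) (ha2u : a₂ ≠ u) (ha1w : a₁ ≠ w) (ha2w : a₂ ≠ w) (how : o ≠ w)
    (hbw : b ≠ w) : ClosedAt R o a₁ a₂ b E ends u := by
  refine closedAt_of_ext (s := s(a₁, w)) (closedAt_of_gadgetUWOAnchor o a₁ a₂ b _ _ u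
    ⟨w, some euw, some euo, none, some ewa2, some ewb, ?_⟩)
  exact
    { ends_uw := by simp [huw]
      ends_uo := by simp [huo]
      ends_wa1 := rfl
      ends_wa2 := by simp [hwa2]
      ends_wb := by simp [hwb]
      ne_uw_uo := by simp [h_uw_uo]
      ne_uw_wa1 := by simp
      ne_uw_wa2 := by simp [h_uw_wa2]
      ne_uw_wb := by simp [h_uw_wb]
      ne_uo_wa1 := by simp
      ne_uo_wa2 := by simp [h_uo_wa2]
      ne_uo_wb := by simp [h_uo_wb]
      ne_wa1_wa2 := by simp
      ne_wa1_wb := by simp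
      ne_wa2_wb := by simp [h_wa2_wb]
      unique_u := by
        intro e he
        cases e with
        | none => exact absurd he (by simp [extEnds, Sym2.mem_iff, ha1u.symm, hwu.symm])
        | some e =>
          rcases hu e he with h | h
          · exact Or.inl (by rw [h])
          · exact Or.inr (by rw [h])
      unique_w := by
        intro e he
        cases e with
        | none => exact Or.inr (Or.inl rfl)
        | some e =>
          rcases hw e he with h | h | h
          · exact Or.inl (by rw [h])
          · exact Or.inr (Or.inr (Or.inl (by rw [h])))
          · exact Or.inr (Or.inr (Or.inr (by rw [h])))
      ne_wu := hwu
      ne_ou := hou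
      ne_bu := hbu
      ne_a1u := ha1u
      ne_a2u := ha2u
      ne_a1w := ha1w
      ne_a2w := ha2w
      ne_ow := how
      ne_bw := hbw }

end Faces

end CaseOne

end Summit.Ventures.PercRepro2
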